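import Summits.Parity.BatemanHorn.Theorems.RoughParitySectorsOddSectorShareLinearOneFormShare
import HarnessLib

/-!
# Route `RoughParitySectors`, crux `OddSectorShareLinear` (stmt-Parity-15629), line `birth`:
# values of a linear member and the share-to-step bookkeeping (`…PrimeBackground.lean`)

`--supports stmt-Parity-15629` file (line lead, cycle 2). `PrimeBackground.anatomy_of_share` (= registered
sub-goal `stub_anatomyOfShare`): the pure-real passage from the sequence's share statement
`|C₁T − O| ≤ εO` to the crux's step `|c⁽ᵐ⁺¹⁾T − c⁽ᵐ⁾| ≤ 3ε c⁽ᵐ⁾` given the set comparisons and the error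
budget; and elementary facts about a value `v : ℤ` of a member through `v.toNat` (positivity of prime
values, `Ω = 1 ↔ prime`, `z`-roughness versus `p_min ≥ z`, odd `Ω` forces `v.toNat > 1`).
No definition, no new fact.
-/

noncomputable section

open Filter Finset Polynomial Asymptotics
open scoped BigOperators Topology ArithmeticFunction.omega ArithmeticFunction.Omega
open Literature.NumberTheory.Sieve

namespace Summit.Parity.BatemanHorn.Cruxes.OddSectorShareLinear.Birth

namespace PrimeBackground

/-! ### Pure-real bookkeeping: from the sequence's share to the crux's step -/

/-- From the share statement for the sequence's cells `C₁, O` to the crux's cells `cp, cm`: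
with `T ≥ 1`, `0 ≤ ε ≤ 1/4`, `|C₁ T − O| ≤ ε O`, `cp ≤ C₁ ≤ cp + E`, `O ≤ cm + E`, `cm ≤ O + E₂` and the
error budget `(T + 1) E + E₂ ≤ ε O` (all quantities `≥ 0`), one gets `|cp T − cm| ≤ 3ε cm`. [folklore] -/
theorem anatomy_of_share {T ε C₁ O cp cm E E₂ : ℝ} (hT : 1 ≤ T) (hε0 : 0 ≤ ε) (hε1 : ε ≤ 1 / 4)
    (hO : 0 ≤ O) (hcm : 0 ≤ cm) (hE : 0 ≤ E) (hE₂ : 0 ≤ E₂)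
    (hshare : |C₁ * T - O| ≤ ε * O) (h1 : cp ≤ C₁) (h2 : C₁ ≤ cp + E) (h3 : O ≤ cm + E)
    (h4 : cm ≤ O + E₂) (hbudget : (T + 1) * E + E₂ ≤ ε * O) :
    |cp * T - cm| ≤ 3 * ε * cm := by
  rw [abs_le] at hshare ⊢
  obtain ⟨hs1, hs2⟩ := hshare
  have hT0 : 0 ≤ T := by linarith
  -- upper: `cp T − cm ≤ C₁ T − O + E ≤ ε O + E`
  have up : cp * T - cm ≤ ε * O + E := by
    have : cp * T ≤ C₁ * T := mul_le_mul_of_nonneg_right h1 hT0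
    linarith
  -- lower: `cp T − cm ≥ (C₁ − E) T − (O + E₂) ≥ −ε O − T E − E₂`
  have lo : -(ε * O) - T * E - E₂ ≤ cp * T - cm := by
    have : (C₁ - E) * T ≤ cp * T := mul_le_mul_of_nonneg_right (by linarith) hT0
    nlinarith
  -- `O ≤ (4/3) cm`
  have hOcm : O ≤ 4 / 3 * cm := by
    have : E ≤ ε * O := by nlinarith
    nlinarith
  constructor <;> nlinarith


/-! ### Values of a member: positivity, primality, roughness -/

/-- A value whose `toNat` is prime is positive. [folklore] -/
theorem pos_of_toNat_prime {v : ℤ} (h : v.toNat.Prime) : 0 < v := by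
  by_contra hle
  rw [Int.toNat_of_nonpos (not_lt.mp hle)] at h
  exact Nat.not_prime_zero h

/-- For `v > 0`: `(p : ℤ) ∣ v ↔ p ∣ v.toNat`. [folklore] -/
theorem natCast_dvd_iff_dvd_toNat {v : ℤ} (hv : 0 < v) (p : ℕ) : (p : ℤ) ∣ v ↔ p ∣ v.toNat := by
  conv_lhs => rw [← Int.toNat_of_nonneg hv.le]
  exact Int.natCast_dvd_natCast

/-- `Ω(v.toNat) = 1` iff `v.toNat` is prime. [folklore] -/
theorem cardFactors_toNat_eq_one_iff {v : ℤ} : Ω v.toNat = 1 ↔ v.toNat.Prime :=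
  ArithmeticFunction.cardFactors_eq_one_iff_prime

/-- A prime value `≥ z` is `z`-rough. [folklore] -/
theorem rough_of_prime_of_le {v : ℤ} {z : ℕ} (hp : v.toNat.Prime) (hz : z ≤ v.toNat) :
    ∀ p ∈ Finset.range z, p.Prime → ¬ ((p : ℤ) ∣ v) := by
  intro p hp' hpp hpv
  rw [natCast_dvd_iff_dvd_toNat (pos_of_toNat_prime hp)] at hpv
  rcases (Nat.dvd_prime hp).mp hpv with h | h
  · exact hpp.ne_one h
  · rw [Finset.mem_range] at hp'; omega

/-- A `z`-rough prime value is `≥ z`. [folklore] -/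
theorem le_of_prime_of_rough {v : ℤ} {z : ℕ} (hp : v.toNat.Prime)
    (hr : ∀ p ∈ Finset.range z, p.Prime → ¬ ((p : ℤ) ∣ v)) : z ≤ v.toNat := by
  by_contra hlt
  refine hr v.toNat (Finset.mem_range.mpr (not_le.mp hlt)) hp ?_
  rw [natCast_dvd_iff_dvd_toNat (pos_of_toNat_prime hp)]

/-- A `z`-rough value `v` with `v.toNat > 1` has least prime factor `≥ z`. [folklore] -/
theorem le_minFac_of_rough {v : ℤ} {z : ℕ} (hv : 1 < v.toNat)
    (hr : ∀ p ∈ Finset.range z, p.Prime → ¬ ((p : ℤ) ∣ v)) : z ≤ v.toNat.minFac := by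
  by_contra hlt
  have hv0 : 0 < v := by
    by_contra h; rw [Int.toNat_of_nonpos (not_lt.mp h)] at hv; omega
  refine hr _ (Finset.mem_range.mpr (not_le.mp hlt)) (Nat.minFac_prime (by omega)) ?_
  rw [natCast_dvd_iff_dvd_toNat hv0]
  exact Nat.minFac_dvd _

/-- A positive value whose least prime factor is `≥ z` is `z`-rough. [folklore] -/
theorem rough_of_le_minFac {v : ℤ} {z : ℕ} (hv : 0 < v) (hz : z ≤ v.toNat.minFac) :
    ∀ p ∈ Finset.range z, p.Prime → ¬ ((p : ℤ) ∣ v) := by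
  intro p hp' hpp hpv
  rw [natCast_dvd_iff_dvd_toNat hv] at hpv
  have := Nat.minFac_le_of_dvd hpp.two_le hpv
  rw [Finset.mem_range] at hp'
  omega

/-- A value with `Ω(v.toNat)` odd has `v.toNat > 1` (and `v > 0`). [folklore] -/
theorem one_lt_toNat_of_odd {v : ℤ} (h : Odd (Ω v.toNat)) : 1 < v.toNat := by
  by_contra hle
  interval_cases hv : v.toNat
  · simp at h
  · simp at h

end PrimeBackground

/-- **Sub-goal (share-to-step bookkeeping)**, registered on crux stmt-Parity-15629 as `stub_anatomyOfShare`,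
verbatim (`PrimeBackground.anatomy_of_share`). [folklore] -/
theorem stub_anatomyOfShare :
    ∀ (T ε C₁ O cp cm E E₂ : ℝ), 1 ≤ T → 0 ≤ ε → ε ≤ 1 / 4 → 0 ≤ O → 0 ≤ cm → 0 ≤ E → 0 ≤ E₂ → |C₁ * T -
    O| ≤ ε * O → cp ≤ C₁ → C₁ ≤ cp + E → O ≤ cm + E → cm ≤ O + E₂ → (T + 1) * E + E₂ ≤ ε * O → |cp * T
    - cm| ≤ 3 * ε * cm :=
  fun _ _ _ _ _ _ _ _ hT hε0 hε1 hO hcm hE hE₂ hs h1 h2 h3 h4 hb =>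
    PrimeBackground.anatomy_of_share hT hε0 hε1 hO hcm hE hE₂ hs h1 h2 h3 h4 hb

end Summit.Parity.BatemanHorn.Cruxes.OddSectorShareLinear.Birth

end
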